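import Literature.NumberTheory.Transcendental.ReciprocalBricks
import Literature.NumberTheory.Transcendental.NesterenkoBricks
import Mathlib.Data.Multiset.Sort
import HarnessLib

/-!
# Nesterenko's bricks, IV: products of `D_N` over consecutive maxima, and the fine brick lemmas

Topic `Literature/NumberTheory/Transcendental`. Toolkit for Nesterenko's denominator theorem
[Nesterenko2008, §2] (the "consecutive-maxima" `lcm` theorem announced as [Ne3] in
[Zudilin2004, (9.3)]): for a product `R(s) = ∏ⱼ Rⱼ(s)` of elementary bricks the partial-fraction
coefficients `B_{ℓ,k}` of `R` are cleared by a product `D_{m(1)} D_{m(2)} ⋯ D_{m(N)}` of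
`D_M = lcm(1,…,M)` taken at the CONSECUTIVE MAXIMA `m(1) ≥ m(2) ≥ ⋯` of an explicit multiset of
integer parameters — one factor per "place" of the multiset, instead of the crude `D_{max}^N`.
This file PROVES the three generic ingredients of that argument (everything here is proved, no
named facts); the theorem itself (Lemmas 5 and 6 of [Nesterenko2008]) is assembled in
`NesterenkoDenominators.lean`.

* `consecMax s` / `lcmTop s N = D_{m(1)} ⋯ D_{m(N)}` — the product of `Nat.lcmUpto` over the `N`
  largest elements (with multiplicity) of a multiset `s : Multiset ℕ`, and its book-keeping:
  `lcmTop_dvd_lcmTop` (monotone in `N`), and the PLACEMENT PRINCIPLE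
  `prod_map_lcmUpto_dvd_lcmTop_of_rel`: if the needed moduli `c` are dominated term-by-term
  (`Multiset.Rel (· ≤ ·) c u`) by elements `u ≤ s` "standing at different places in the set"
  ([Nesterenko2008, p. 282]), then `∏_{x ∈ c} D_x ∣ lcmTop s (card c)`
  (a sublist of a non-increasing list is dominated by its prefix of the same length).
* `isInt_mul_divDeriv_prod` — the MULTI-MODULUS Leibniz rule behind [Nesterenko2008, (8) and the
  display after it on p. 282]: if `d_i^t · 𝒟_t f_i(x) ∈ ℤ` for every factor (`IsDInt (d i)`), then
  `L · 𝒟_t(∏ f_i)(x) ∈ ℤ` for every `L` divisible by `∏ d_i^{τ_i}` for all exponent vectors `τ`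
  with `∑ τ_i ≤ t` (the tree's `IsDInt.prod` is the one-modulus case `L = d^t`).
* the FINE brick lemmas at an integer point `-k` with the modulus
  `M = max(k - a, a + m - 1 - k)` of [Nesterenko2008, Lemmas 3–4] (distance from `k` to the far
  end of the brick's segment `Δ = [a, a+m-1]`), sharper than the enclosing-interval modulus
  `D_{b₀-a₀-1}` of [Zudilin2004, Lemma 16] = `recipBrickReg_isDInt`:
  `recipBrickReg_isDInt_of_bound` (any `M` with `|a+l-k| ≤ M` for the poles `-(a+l) ≠ -k`),
  `recipBrickReg_isDInt_max` (Lemma 4: `k ∈ Δ`, `D_M^t 𝒟_t[R(t)(t+k)](-k) ∈ ℤ`) and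
  `recipBrick_isDInt_smul` (Lemma 3: `k ∉ Δ`, `D_M^{t+1} 𝒟_t R(-k) ∈ ℤ`, stated as
  `IsDInt D_M N (D_M • R) (-k)`).

Sources. [Nesterenko2008] §2 was read from the publisher/Google previews (pp. 277, 279, 281–283:
definitions (7)–(8), Lemmas 1–2, the last line of Lemma 4, Lemmas 5–6 with proofs); p. 280
(the displayed statements of Lemmas 3–4) is not available to us, and the moduli used here are
the ones the printed proofs of Lemmas 5–6 invoke (`M = max(ℓ - a_j, b_j - 1 - ℓ)`, p. 281 l. 17,
p. 282 l. 12). Since everything in this file is proved, the citations are attributions only.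

## References

* [Nesterenko2008] Yu. V. Nesterenko, *Construction of approximations to zeta-values*, in:
  Diophantine Approximation (Festschrift W. Schmidt), Dev. Math. 16, Springer 2008, 275–293, §2.
* [Zudilin2004] W. Zudilin, *Arithmetic of linear forms involving odd zeta values*, J. Théor.
  Nombres Bordeaux 16 (2004), 251–291, §7 Lemmas 15–16, §9 (9.3).
-/

noncomputable section

open Finset Filter Topology Literature.Analysis.Calculus
open scoped Nat

namespace Literature.NumberTheory.Transcendental

/-! ### Consecutive maxima of a multiset and the product `D_{m(1)} ⋯ D_{m(N)}` -/

/-- The elements of a finite multiset of naturals listed in non-increasing order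
`m(1) ≥ m(2) ≥ ⋯` — its "consecutive maxima" in the terminology of [Nesterenko2008, Lemmas 5–6]
("successive maxima" in [Zudilin2004, (9.3)]). [cite: Nesterenko2008, §2 Lemma 5 p. 281] -/
def consecMax (s : Multiset ℕ) : List ℕ := (s.sort (· ≤ ·)).reverse

/-- `consecMax s` is non-increasing. [folklore] -/
private theorem consecMax_pairwise (s : Multiset ℕ) : (consecMax s).Pairwise (· ≥ ·) := by
  unfold consecMax
  rw [List.pairwise_reverse]
  exact Multiset.pairwise_sort s (· ≤ ·)

/-- `consecMax s` enumerates `s`. [folklore] -/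
private theorem coe_consecMax (s : Multiset ℕ) : (consecMax s : Multiset ℕ) = s := by
  unfold consecMax
  rw [Multiset.coe_reverse, Multiset.sort_eq]

/-- `lcmTop s N = D_{m(1)} D_{m(2)} ⋯ D_{m(N)}`: the product of `D_M = lcm(1,…,M)` (`Nat.lcmUpto`)
over the `N` consecutive maxima `m(1) ≥ ⋯ ≥ m(N)` of the multiset `s` (all of them if
`N ≥ card s`). [cite: Nesterenko2008, §2 Lemmas 5–6 p. 281] -/
def lcmTop (s : Multiset ℕ) (N : ℕ) : ℕ := (((consecMax s).take N).map Nat.lcmUpto).prod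

/-- A product of `lcmUpto`'s over a list is positive. [folklore] -/
private theorem prod_map_lcmUpto_pos (l : List ℕ) : 0 < (l.map Nat.lcmUpto).prod := by
  induction l with
  | nil => simp
  | cons a l ih =>
    rw [List.map_cons, List.prod_cons]
    exact Nat.mul_pos (Nat.lcmUpto_pos a) ih

/-- `lcmTop s N > 0` (each `D_M ≥ 1`). [cite: Nesterenko2008, §2 Lemma 6 p. 281] -/
theorem lcmTop_pos (s : Multiset ℕ) (N : ℕ) : 0 < lcmTop s N :=
  prod_map_lcmUpto_pos _

/-- `lcmTop s 0 = 1`. [folklore] -/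
@[simp] private theorem lcmTop_zero (s : Multiset ℕ) : lcmTop s 0 = 1 := by
  simp [lcmTop]

/-- Monotonicity in the number of factors: `lcmTop s N ∣ lcmTop s N'` for `N ≤ N'` (fewer
consecutive maxima give a divisor). [cite: Nesterenko2008, §2 Lemma 6 p. 281] -/
theorem lcmTop_dvd_lcmTop (s : Multiset ℕ) {N N' : ℕ} (h : N ≤ N') : lcmTop s N ∣ lcmTop s N' := by
  unfold lcmTop
  have : (consecMax s).take N' = (consecMax s).take N ++ ((consecMax s).take N').drop N := by
    conv_lhs => rw [← List.take_append_drop N ((consecMax s).take N')]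
    rw [List.take_take, min_eq_left h]
  rw [this, List.map_append, List.prod_append]
  exact dvd_mul_right _ _

/-- Every element of `consecMax s` lies in `s`. [folklore] -/
private theorem mem_of_mem_consecMax {s : Multiset ℕ} {x : ℕ} (h : x ∈ consecMax s) : x ∈ s := by
  rw [← coe_consecMax s]
  exact Multiset.mem_coe.2 h

/-- The crude bound: if every element of `s` is `≤ m` then `D_{m(1)} ⋯ D_{m(N)} ∣ D_m^N` (each
consecutive maximum is `≤ m`; [Nesterenko2008] improves the classical `D_m^N` to the product over
the consecutive maxima). [cite: Nesterenko2008, §2 Lemma 6 p. 281] -/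
theorem lcmTop_dvd_pow (s : Multiset ℕ) {m : ℕ} (h : ∀ x ∈ s, x ≤ m) (N : ℕ) :
    lcmTop s N ∣ Nat.lcmUpto m ^ N := by
  unfold lcmTop
  have key : ∀ L : List ℕ, (∀ x ∈ L, x ≤ m) → ∀ N : ℕ,
      ((L.take N).map Nat.lcmUpto).prod ∣ Nat.lcmUpto m ^ N := by
    intro L hL
    induction L with
    | nil => intro N; simp
    | cons a L ih =>
      intro N
      rcases N with _ | N
      · simp
      · rw [List.take_succ_cons, List.map_cons, List.prod_cons, pow_succ']
        exact mul_dvd_mul (lcmUpto_dvd_lcmUpto (hL a (by simp)))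
          (ih (fun x hx => hL x (List.mem_cons_of_mem a hx)) N)
  exact key _ (fun x hx => h x (mem_of_mem_consecMax hx)) N

/-- One step of the placement principle: in a list bounded by `a`, the product over the first
`n+1` entries divides `D_a` times the product over the first `n` entries. [folklore] -/
private theorem prod_map_lcmUpto_take_succ_dvd {a : ℕ} :
    ∀ (L : List ℕ) (n : ℕ), (∀ b ∈ L, b ≤ a) →
      ((L.take (n + 1)).map Nat.lcmUpto).prod ∣
        Nat.lcmUpto a * ((L.take n).map Nat.lcmUpto).prod
  | [], n, _ => by simp
  | b :: L, 0, h => by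
      simpa using lcmUpto_dvd_lcmUpto (h b (by simp))
  | b :: L, n + 1, h => by
      have ih := prod_map_lcmUpto_take_succ_dvd L n fun c hc => h c (List.mem_cons_of_mem b hc)
      simp only [List.take_succ_cons, List.map_cons, List.prod_cons]
      calc Nat.lcmUpto b * ((L.take (n + 1)).map Nat.lcmUpto).prod
          ∣ Nat.lcmUpto b * (Nat.lcmUpto a * ((L.take n).map Nat.lcmUpto).prod) :=
            mul_dvd_mul_left _ ih
        _ = Nat.lcmUpto a * (Nat.lcmUpto b * ((L.take n).map Nat.lcmUpto).prod) := by ring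

/-- **Placement principle, list form**: a sublist of a non-increasing list `L` is dominated
term-by-term by the prefix of `L` of the same length, hence its `D`-product divides that of the
prefix. [folklore] -/
private theorem prod_map_lcmUpto_dvd_of_sublist {l L : List ℕ} (h : l.Sublist L)
    (hL : L.Pairwise (· ≥ ·)) :
    (l.map Nat.lcmUpto).prod ∣ ((L.take l.length).map Nat.lcmUpto).prod := by
  induction h with
  | slnil => simp
  | @cons l₁ L₂ a _ ih =>
      have hL₂ : L₂.Pairwise (· ≥ ·) := (List.pairwise_cons.1 hL).2
      have ha : ∀ b ∈ L₂, b ≤ a := (List.pairwise_cons.1 hL).1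
      rcases Nat.eq_zero_or_pos l₁.length with hl | hl
      · rw [List.eq_nil_of_length_eq_zero hl]
        simp
      · obtain ⟨n, hn⟩ := Nat.exists_eq_succ_of_ne_zero hl.ne'
        rw [hn, List.take_succ_cons, List.map_cons, List.prod_cons]
        calc (l₁.map Nat.lcmUpto).prod ∣ ((L₂.take l₁.length).map Nat.lcmUpto).prod := ih hL₂
          _ = ((L₂.take (n + 1)).map Nat.lcmUpto).prod := by rw [hn]
          _ ∣ Nat.lcmUpto a * ((L₂.take n).map Nat.lcmUpto).prod :=
            prod_map_lcmUpto_take_succ_dvd L₂ n ha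
  | @cons_cons l₁ L₂ a _ ih =>
      have hL₂ : L₂.Pairwise (· ≥ ·) := (List.pairwise_cons.1 hL).2
      simp only [List.length_cons, List.take_succ_cons, List.map_cons, List.prod_cons]
      exact mul_dvd_mul_left _ (ih hL₂)

/-- **Placement principle, multiset form**: for a sub-multiset `u ≤ s`,
`∏_{x ∈ u} D_x ∣ D_{m(1)} ⋯ D_{m(card u)}` (the `card u` consecutive maxima of `s`). [folklore] -/
private theorem prod_map_lcmUpto_dvd_lcmTop {u s : Multiset ℕ} (h : u ≤ s) :
    (u.map Nat.lcmUpto).prod ∣ lcmTop s (Multiset.card u) := by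
  induction u using Quotient.inductionOn with
  | h l =>
    have h' : (l : Multiset ℕ) ≤ (consecMax s : Multiset ℕ) := by rwa [coe_consecMax]
    rw [Multiset.coe_le] at h'
    obtain ⟨l', hp, hsub⟩ := h'
    have h1 : ((l : Multiset ℕ).map Nat.lcmUpto).prod = (l'.map Nat.lcmUpto).prod := by
      rw [Multiset.map_coe, Multiset.prod_coe]
      exact ((hp.map _).prod_eq).symm
    change ((l : Multiset ℕ).map Nat.lcmUpto).prod ∣ lcmTop s (Multiset.card (l : Multiset ℕ))
    rw [h1, Multiset.coe_card, ← hp.length_eq]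
    exact prod_map_lcmUpto_dvd_of_sublist hsub (consecMax_pairwise s)

/-- Term-by-term domination `Multiset.Rel (· ≤ ·) c u` gives `∏_{x∈c} D_x ∣ ∏_{y∈u} D_y`.
[folklore] -/
private theorem prod_map_lcmUpto_dvd_of_rel {c u : Multiset ℕ} (h : Multiset.Rel (· ≤ ·) c u) :
    (c.map Nat.lcmUpto).prod ∣ (u.map Nat.lcmUpto).prod := by
  induction c using Multiset.induction_on generalizing u with
  | empty =>
    rw [Multiset.rel_zero_left] at h
    subst h
    simp
  | cons a c ih =>
    obtain ⟨b, u', hab, hcu', rfl⟩ := Multiset.rel_cons_left.1 h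
    simp only [Multiset.map_cons, Multiset.prod_cons]
    exact mul_dvd_mul (lcmUpto_dvd_lcmUpto hab) (ih hcu')

/-- **Placement principle** ([Nesterenko2008, p. 282]: "these denominators can be chosen as
standing at different places in the set"): if the needed moduli `c` are dominated term-by-term
by elements `u` occupying different places of `s` (`u ≤ s`), then
`∏_{x ∈ c} D_x ∣ D_{m(1)} ⋯ D_{m(card c)}`. [cite: Nesterenko2008, §2 proof of Lemma 6 p. 282] -/
theorem prod_map_lcmUpto_dvd_lcmTop_of_rel {c u s : Multiset ℕ} (hcu : Multiset.Rel (· ≤ ·) c u)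
    (hus : u ≤ s) : (c.map Nat.lcmUpto).prod ∣ lcmTop s (Multiset.card c) := by
  rw [Multiset.card_eq_card_of_rel hcu]
  exact (prod_map_lcmUpto_dvd_of_rel hcu).trans (prod_map_lcmUpto_dvd_lcmTop hus)

/-! ### The multi-modulus Leibniz rule -/

/-- **Multi-modulus Leibniz rule.** Let `f_i` (`i ∈ s`) satisfy `d_i^t · 𝒟_t f_i(x) ∈ ℤ` for
`t ≤ T` (`IsDInt (d i) T (f i) x`, `d_i ≥ 1`). If a natural number `L` is divisible by
`∏_i d_i^{τ_i}` for EVERY exponent vector `τ` with `∑_{i∈s} τ_i ≤ t` (`t ≤ T`), then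
`L · 𝒟_t(∏_{i∈s} f_i)(x) ∈ ℤ`. (Leibniz: `𝒟_t(∏ f_i) = ∑_{∑τ_i = t} ∏_i 𝒟_{τ_i} f_i`,
[Nesterenko2008, p. 282, display 2].) [cite: Nesterenko2008, §2 proof of Lemma 6 p. 282] -/
theorem isInt_mul_divDeriv_prod {ι : Type*} [DecidableEq ι] (s : Finset ι) {f : ι → ℚ → ℚ}
    {d : ι → ℕ} {T : ℕ} {x : ℚ} (hd : ∀ i ∈ s, 0 < d i) (hf : ∀ i ∈ s, IsDInt (d i) T (f i) x) :
    ∀ t ≤ T, ∀ L : ℕ, (∀ τ : ι → ℕ, (∑ i ∈ s, τ i) ≤ t → (∏ i ∈ s, d i ^ τ i) ∣ L) →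
      ∃ z : ℤ, (L : ℚ) * divDeriv t (fun y => ∏ i ∈ s, f i y) x = z := by
  induction s using Finset.induction_on with
  | empty =>
    intro t _ L _
    simp only [prod_empty, divDeriv_const]
    split_ifs
    · exact ⟨L, by push_cast; ring⟩
    · exact ⟨0, by simp⟩
  | insert a s ha ih =>
    intro t ht L hL
    have hfa : IsDInt (d a) T (f a) x := hf a (mem_insert_self a s)
    have hfs : ∀ i ∈ s, IsDInt (d i) T (f i) x := fun i hi => hf i (mem_insert_of_mem hi)
    have hds : ∀ i ∈ s, 0 < d i := fun i hi => hd i (mem_insert_of_mem hi)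
    have hda : 0 < d a := hd a (mem_insert_self a s)
    -- smoothness of the two factors
    have hca : ContDiffAt ℚ t (f a) x := hfa.contDiffAt.of_le (by exact_mod_cast ht)
    have hPs : IsDInt 0 T (fun y => ∏ i ∈ s, f i y) x :=
      IsDInt.prod s fun i hi => (hfs i hi).of_dvd (dvd_zero _)
    have hcs : ContDiffAt ℚ t (fun y => ∏ i ∈ s, f i y) x :=
      hPs.contDiffAt.of_le (by exact_mod_cast ht)
    simp only [prod_insert ha]
    rw [divDeriv_fun_mul hca hcs, mul_sum]
    have hterm : ∀ i ∈ range (t + 1), ∃ z : ℤ,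
        (L : ℚ) * (divDeriv i (f a) x * divDeriv (t - i) (fun y => ∏ i ∈ s, f i y) x) = z := by
      intro i hi
      have hit : i ≤ t := Nat.lt_succ_iff.1 (mem_range.1 hi)
      -- `d a ^ i ∣ L`
      have hdiv : d a ^ i ∣ L := by
        have h1 := hL (Function.update (fun _ => 0) a i) (by
          rw [sum_insert ha, Function.update_self]
          have : ∑ j ∈ s, Function.update (fun _ : ι => (0 : ℕ)) a i j = 0 :=
            sum_eq_zero fun j hj => by
              rw [Function.update_of_ne (by rintro rfl; exact ha hj)]
          omega)
        rw [prod_insert ha, Function.update_self] at h1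
        have : ∏ j ∈ s, d j ^ Function.update (fun _ : ι => (0 : ℕ)) a i j = 1 :=
          prod_eq_one fun j hj => by
            rw [Function.update_of_ne (by rintro rfl; exact ha hj), pow_zero]
        rw [this, mul_one] at h1
        exact h1
      obtain ⟨L', hL'⟩ := hdiv
      -- the hypothesis for `L'` on `s` at order `t - i`
      have hL'' : ∀ τ : ι → ℕ, (∑ j ∈ s, τ j) ≤ t - i → (∏ j ∈ s, d j ^ τ j) ∣ L' := by
        intro τ hτ
        have h1 := hL (Function.update τ a i) (by
          rw [sum_insert ha, Function.update_self]
          have : ∑ j ∈ s, Function.update τ a i j = ∑ j ∈ s, τ j :=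
            sum_congr rfl fun j hj => by rw [Function.update_of_ne (by rintro rfl; exact ha hj)]
          rw [this]
          omega)
        rw [prod_insert ha, Function.update_self] at h1
        have : ∏ j ∈ s, d j ^ Function.update τ a i j = ∏ j ∈ s, d j ^ τ j :=
          prod_congr rfl fun j hj => by rw [Function.update_of_ne (by rintro rfl; exact ha hj)]
        rw [this, hL'] at h1
        exact Nat.dvd_of_mul_dvd_mul_left (pow_pos hda i) h1
      obtain ⟨z₁, hz₁⟩ := hfa.isInt i (hit.trans ht)
      obtain ⟨z₂, hz₂⟩ := ih hds hfs (t - i) ((Nat.sub_le t i).trans ht) L' hL''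
      refine ⟨z₁ * z₂, ?_⟩
      rw [hL']
      push_cast
      rw [← hz₁, ← hz₂]
      ring
    choose! z hz using hterm
    refine ⟨∑ i ∈ range (t + 1), z i, ?_⟩
    push_cast
    exact sum_congr rfl hz

/-! ### The fine brick lemmas (Nesterenko's Lemmas 3 and 4) -/

/-- The reciprocal brick `R(t) = (m-1)!/((t+a)⋯(t+a+m-1))` regularised at `t = -k`
(`recipBrickReg a m k = R(t)(t+k)`): `D_M^j · 𝒟_j [R(t)(t+k)](-k) ∈ ℤ` for every `M` bounding
the distances `|a + l - k|` from `k` to the poles other than `-k` (the Nikishin–Rivoal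
partial-fraction scheme of [Zudilin2004, Lemma 16], with the modulus read off the distances).
[cite: Nesterenko2008, §2 Lemma 4 (proof) p. 281] -/
theorem recipBrickReg_isDInt_of_bound (a : ℤ) {m : ℕ} (hm : 1 ≤ m) (k : ℤ) (M : ℕ)
    (hM : ∀ l : ℕ, l < m → a + (l : ℤ) ≠ k → (a + l - k).natAbs ≤ M) (N : ℕ) :
    IsDInt (Nat.lcmUpto M) N (recipBrickReg a m k) (-(k : ℚ)) := by
  set d := Nat.lcmUpto M with hd
  -- the partial-fraction form `F`
  set C : ℕ → ℤ := fun l => (-1) ^ l * ((m - 1).choose l : ℤ) with hC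
  set F : ℚ → ℚ := fun t => ∑ l ∈ range m, (C l : ℚ) * quotReg a l k t with hF
  have hFint : IsDInt d N F (-(k : ℚ)) := by
    refine IsDInt.sum (range m) fun l hl => (quotReg_isDInt d N a l k fun hne => ?_).int_mul (C l)
    have hl' := mem_range.1 hl
    have hne0 : a + l - k ≠ 0 := sub_ne_zero.2 hne
    have hle : (a + l - k).natAbs ≤ M := hM l hl' hne
    have h1 : 1 ≤ (a + l - k).natAbs := Int.natAbs_pos.2 hne0
    have := dvd_lcmUpto h1 hle
    rw [← hd] at this
    exact Int.natAbs_dvd.1 (Int.natCast_dvd_natCast.2 this)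
  -- `F = recipBrickReg a m k` near `-k`
  have heq : ∀ᶠ t : ℚ in 𝓝[≠] (-(k : ℚ)), F t = recipBrickReg a m k t := by
    filter_upwards [eventually_ne_poles a m k] with t ht
    rw [recipBrickReg_eq a m k ht.1, recipBrick, hF]
    simp only
    rw [prod_inv_distrib, inv_prod_eq_sum_nodalWeight a hm t ht.2, mul_sum, sum_mul]
    refine sum_congr rfl fun l hl => ?_
    have hl' := mem_range.1 hl
    have hcoef := factorial_mul_nodalWeight_range a m l hl'
    have hfne : ((m - 1)! : ℚ) ≠ 0 := by exact_mod_cast (Nat.factorial_pos _).ne'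
    have hcoef' : Lagrange.nodalWeight (range m) (fun l' : ℕ => -((a + (l' : ℤ) : ℤ) : ℚ)) l
        = (((m - 1)! : ℚ))⁻¹ * ((-1) ^ l * ((m - 1).choose l : ℚ)) := by
      rw [← hcoef, ← mul_assoc, inv_mul_cancel₀ hfne, one_mul]
    rw [quotReg_eq a l k (ht.2 l hl), hcoef', hC]
    simp only
    push_cast
    field_simp
  -- continuity of both sides at `-k`
  have hFc : ContinuousAt F (-(k : ℚ)) := hFint.contDiffAt.continuousAt
  have hRc : ContinuousAt (recipBrickReg a m k) (-(k : ℚ)) := by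
    have hcd : ContDiffAt ℚ 0 (recipBrickReg a m k) (-(k : ℚ)) := by
      unfold recipBrickReg
      refine (contDiffAt_const.mul (contDiffAt_prod fun l hl => ?_)).mul ?_
      · have hl' := (mem_filter.1 hl).2
        refine contDiffAt_inv_add_const ?_
        rw [show (-(k : ℚ) + ((a + (l : ℤ) : ℤ) : ℚ)) = ((a + l - k : ℤ) : ℚ) by push_cast; ring]
        exact_mod_cast sub_ne_zero.2 hl'
      · split_ifs
        · exact contDiffAt_const
        · exact contDiffAt_id.add contDiffAt_const
    exact hcd.continuousAt
  exact hFint.congr (eventuallyEq_of_nhdsNE hFc hRc heq)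

/-- The distances from `k` to the points of the segment `Δ = [a, a+m-1]` are bounded by
`M = max(k - a, a + m - 1 - k)` ([Nesterenko2008]: `M = max(ℓ - a_j, b_j - 1 - ℓ)`).
[folklore] -/
private theorem natAbs_sub_le_max (a : ℤ) (m : ℕ) (k : ℤ) (l : ℕ) (hl : l < m) :
    (a + l - k).natAbs ≤ (max (k - a) (a + m - 1 - k)).toNat := by
  rcases le_or_gt k (a + l) with h | h
  · have h1 : (a + l - k).natAbs = (a + l - k).toNat := by omega
    rw [h1]
    exact Int.toNat_le_toNat ((le_max_right _ _).trans' (by omega))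
  · have h1 : (a + l - k).natAbs = (k - (a + l)).toNat := by omega
    rw [h1]
    exact Int.toNat_le_toNat ((le_max_left _ _).trans' (by omega))

/-- **[Nesterenko2008, Lemma 4]** (fine arithmetic of the reciprocal brick at one of its poles):
for `R(t) = (m-1)!/((t+a)⋯(t+a+m-1))`, an integer `k` with `a ≤ k ≤ a + m - 1` and
`M = max(k - a, a + m - 1 - k)`, one has `D_M^j · 𝒟_j[R(t)(t+k)](-k) ∈ ℤ` for all `j`
(printed: `(1/t!)(d/dz)^t (G(z)(z+ℓ))|_{z=-ℓ} = -∑_{i ≠ ℓ} c_i (ℓ - i)^{-t}` with `c_i ∈ ℤ` and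
`|ℓ - i| ≤ M`, p. 281). The hypothesis `k ∈ Δ` is not needed for the statement in this form
(see `recipBrickReg_isDInt_of_bound`); it is recorded in the name only.
[cite: Nesterenko2008, §2 Lemma 4 p. 280–281] -/
theorem recipBrickReg_isDInt_max (a : ℤ) {m : ℕ} (hm : 1 ≤ m) (k : ℤ) (N : ℕ) :
    IsDInt (Nat.lcmUpto (max (k - a) (a + m - 1 - k)).toNat) N (recipBrickReg a m k) (-(k : ℚ)) :=
  recipBrickReg_isDInt_of_bound a hm k _ (fun l hl _ => natAbs_sub_le_max a m k l hl) N

/-- **[Nesterenko2008, Lemma 3]** (fine arithmetic of the reciprocal brick at a regular integer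
point), in the form used on pp. 281–282: for `R(t) = (m-1)!/((t+a)⋯(t+a+m-1))`, an integer
`k ∉ [a, a+m-1]` and `M = max(k - a, a + m - 1 - k)`, one has `D_M^{j+1} · 𝒟_j R(-k) ∈ ℤ` for
all `j`, i.e. `IsDInt D_M N (D_M · R) (-k)` (partial fractions `R = ∑ c_i/(t+i)`, `c_i ∈ ℤ`,
`𝒟_j[(t+i)⁻¹](-k) = ±(i-k)^{-j-1}`, `|i - k| ≤ M`). [cite: Nesterenko2008, §2 Lemma 3 p. 279–281] -/
theorem recipBrick_isDInt_smul (a : ℤ) {m : ℕ} (hm : 1 ≤ m) (k : ℤ) (hk : k < a ∨ a + m ≤ k)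
    (N : ℕ) :
    IsDInt (Nat.lcmUpto (max (k - a) (a + m - 1 - k)).toNat) N
      (fun t => (Nat.lcmUpto (max (k - a) (a + m - 1 - k)).toNat : ℚ) * recipBrick a m t)
      (-(k : ℚ)) := by
  set M := (max (k - a) (a + m - 1 - k)).toNat with hMdef
  set d := Nat.lcmUpto M with hd
  -- no pole at `-k`
  have hne : ∀ l : ℕ, l < m → a + (l : ℤ) ≠ k := fun l hl h => by omega
  -- `(a + l - k) ∣ d`
  have hdvd : ∀ l : ℕ, l < m → (a + l - k) ∣ (d : ℤ) := by
    intro l hl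
    have hne0 : a + l - k ≠ 0 := sub_ne_zero.2 (hne l hl)
    have hle : (a + l - k).natAbs ≤ M := natAbs_sub_le_max a m k l hl
    have h1 : 1 ≤ (a + l - k).natAbs := Int.natAbs_pos.2 hne0
    have := dvd_lcmUpto h1 hle
    rw [← hd] at this
    exact Int.natAbs_dvd.1 (Int.natCast_dvd_natCast.2 this)
  -- the partial-fraction form `F`, with the integers `E_l = d/(a+l-k)`
  set C : ℕ → ℤ := fun l => (-1) ^ l * ((m - 1).choose l : ℤ) with hC
  set E : ℕ → ℤ := fun l => (d : ℤ) / (a + l - k) with hEdef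
  have hE : ∀ l : ℕ, l < m → (E l : ℚ) * (((a + (l : ℤ) : ℤ) - k : ℤ) : ℚ) = d := by
    intro l hl
    have h1 : E l * (a + l - k) = d := Int.ediv_mul_cancel (hdvd l hl)
    have h2 : ((a + (l : ℤ) : ℤ) - k : ℤ) = a + l - k := by ring
    rw [h2]
    exact_mod_cast h1
  set F : ℚ → ℚ := fun t => ∑ l ∈ range m,
    ((C l * E l : ℤ) : ℚ) * ((((a + (l : ℤ) : ℤ) - k : ℤ) : ℚ) * (t + ((a + (l : ℤ) : ℤ) : ℚ))⁻¹)
    with hF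
  have hFint : IsDInt d N F (-(k : ℚ)) := by
    refine IsDInt.sum (range m) fun l hl => (isDInt_sub_mul_inv d N (hne l (mem_range.1 hl))
      ?_).int_mul (C l * E l)
    have := hdvd l (mem_range.1 hl)
    rwa [show ((a + (l : ℤ) : ℤ) - k : ℤ) = a + l - k by ring]
  -- a neighbourhood of `-k` avoiding all the poles `-(a+l)`
  have hnhds : ∀ᶠ t : ℚ in 𝓝 (-(k : ℚ)), ∀ l ∈ range m, t + ((a + (l : ℤ) : ℤ) : ℚ) ≠ 0 := by
    refine (eventually_all_finset (range m)).2 fun l hl => ?_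
    have hl' := mem_range.1 hl
    have h0 : (-(k : ℚ)) + ((a + (l : ℤ) : ℤ) : ℚ) ≠ 0 := by
      rw [show (-(k : ℚ) + ((a + (l : ℤ) : ℤ) : ℚ)) = ((a + l - k : ℤ) : ℚ) by push_cast; ring]
      exact_mod_cast sub_ne_zero.2 (hne l hl')
    exact ((continuous_id.add continuous_const).continuousAt.eventually_ne h0)
  -- `F = d · recipBrick a m` there
  have heq : F =ᶠ[𝓝 (-(k : ℚ))] fun t => (d : ℚ) * recipBrick a m t := by
    filter_upwards [hnhds] with t ht
    rw [recipBrick, hF]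
    simp only
    rw [prod_inv_distrib, inv_prod_eq_sum_nodalWeight a hm t ht, mul_sum, mul_sum]
    refine sum_congr rfl fun l hl => ?_
    have hl' := mem_range.1 hl
    have hcoef := factorial_mul_nodalWeight_range a m l hl'
    have hfne : ((m - 1)! : ℚ) ≠ 0 := by exact_mod_cast (Nat.factorial_pos _).ne'
    have hcoef' : Lagrange.nodalWeight (range m) (fun l' : ℕ => -((a + (l' : ℤ) : ℤ) : ℚ)) l
        = (((m - 1)! : ℚ))⁻¹ * ((-1) ^ l * ((m - 1).choose l : ℚ)) := by
      rw [← hcoef, ← mul_assoc, inv_mul_cancel₀ hfne, one_mul]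
    rw [hcoef']
    have hEl := hE l hl'
    calc ((C l * E l : ℤ) : ℚ) * ((((a + (l : ℤ) : ℤ) - k : ℤ) : ℚ) * (t + ((a + (l : ℤ) : ℤ) : ℚ))⁻¹)
        = (C l : ℚ) * ((E l : ℚ) * (((a + (l : ℤ) : ℤ) - k : ℤ) : ℚ)) *
            (t + ((a + (l : ℤ) : ℤ) : ℚ))⁻¹ := by push_cast; ring
      _ = (C l : ℚ) * (d : ℚ) * (t + ((a + (l : ℤ) : ℤ) : ℚ))⁻¹ := by rw [hEl]
      _ = (d : ℚ) * (((m - 1)! : ℚ) * ((((m - 1)! : ℚ))⁻¹ * ((-1) ^ l * ((m - 1).choose l : ℚ)) *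
            (t + ((a + (l : ℤ) : ℤ) : ℚ))⁻¹)) := by
          rw [hC, ← mul_assoc ((m - 1)! : ℚ), ← mul_assoc ((m - 1)! : ℚ),
            mul_inv_cancel₀ hfne, one_mul]
          push_cast
          ring
  exact hFint.congr heq

end Literature.NumberTheory.Transcendental
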